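import Mathlib
import HarnessLib
import Summits.RiemannHypothesis.RiemannHypothesis.Theorems.ScrewLemmaKExtremalRayDefs

/-!
# Route `ScrewLemmaKExtremalRay` — the Gram ray `r(t) = 1 − (10/3)√t + (5/2)t`: moments and bounds

`∫₀¹ r = 1/36`, `∫₀¹ r(t)√t dt = 0`, `∫₀¹ r(t)·t dt = 0` and `∫₀¹ r² = 1/36` (so `r ⊥ √t, t` and
`∫ r = ‖r‖² = 1/36`; cf. the tree's K3 file `ScrewLemmaKCoprofileMomentGramFloor`), `|r| ≤ 5` on `[0,1]`, continuity.  One FTC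
lemma for `a + b t^{1/2} + c t + d t^{3/2} + e t²` does all four integrals.  Inputs of crux E1
`NearExtremalGenerators` (stmt-RiemannHypothesis-22262).  RH-free; nothing here bears on the truth of
RH.
-/

set_option linter.dupNamespace false

noncomputable section

namespace Summit.RiemannHypothesis.RiemannHypothesis.Theorems.ScrewLemmaKExtremalRay

open MeasureTheory Set Real intervalIntegral

/-- FTC: `∫₀¹ (a + b t^{1/2} + c t + d t^{3/2} + e t²) dt = a + (2/3)b + c/2 + (2/5)d + e/3`.
[folklore] -/
theorem integral_rpow_combination (a b c d e : ℝ) :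
    ∫ t in (0:ℝ)..1, (a + b * t ^ (1 / 2 : ℝ) + c * t + d * t ^ (3 / 2 : ℝ) + e * t ^ 2)
      = a + 2 / 3 * b + c / 2 + 2 / 5 * d + e / 3 := by
  have hderiv : ∀ t ∈ uIcc (0:ℝ) 1, HasDerivAt (fun x : ℝ =>
      a * x + 2 / 3 * b * x ^ (3 / 2 : ℝ) + c / 2 * x ^ 2 + 2 / 5 * d * x ^ (5 / 2 : ℝ)
        + e / 3 * x ^ 3)
      (a + b * t ^ (1 / 2 : ℝ) + c * t + d * t ^ (3 / 2 : ℝ) + e * t ^ 2) t := by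
    intro t _
    have h32 : HasDerivAt (fun x : ℝ => x ^ (3 / 2 : ℝ)) ((3 / 2 : ℝ) * t ^ ((3 / 2 : ℝ) - 1)) t :=
      Real.hasDerivAt_rpow_const (Or.inr (by norm_num))
    have h52 : HasDerivAt (fun x : ℝ => x ^ (5 / 2 : ℝ)) ((5 / 2 : ℝ) * t ^ ((5 / 2 : ℝ) - 1)) t :=
      Real.hasDerivAt_rpow_const (Or.inr (by norm_num))
    rw [show (3 / 2 : ℝ) - 1 = 1 / 2 by norm_num] at h32
    rw [show (5 / 2 : ℝ) - 1 = 3 / 2 by norm_num] at h52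
    have h1 : HasDerivAt (fun x : ℝ => x) 1 t := hasDerivAt_id t
    have h2 : HasDerivAt (fun x : ℝ => x ^ 2) (2 * t) t := by simpa using hasDerivAt_pow 2 t
    have h3 : HasDerivAt (fun x : ℝ => x ^ 3) (3 * t ^ 2) t := by simpa using hasDerivAt_pow 3 t
    have key := ((((h1.const_mul a).add (h32.const_mul (2 / 3 * b))).add (h2.const_mul (c / 2))).add
      (h52.const_mul (2 / 5 * d))).add (h3.const_mul (e / 3))
    exact key.congr_deriv (by ring)
  have hint : IntervalIntegrable
      (fun t : ℝ => a + b * t ^ (1 / 2 : ℝ) + c * t + d * t ^ (3 / 2 : ℝ) + e * t ^ 2) volume 0 1 := by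
    apply ContinuousOn.intervalIntegrable
    rw [uIcc_of_le zero_le_one]
    intro t _
    apply ContinuousAt.continuousWithinAt
    have c1 : ContinuousAt (fun x : ℝ => x ^ (1 / 2 : ℝ)) t :=
      Real.continuousAt_rpow_const t (1 / 2) (Or.inr (by norm_num))
    have c2 : ContinuousAt (fun x : ℝ => x ^ (3 / 2 : ℝ)) t :=
      Real.continuousAt_rpow_const t (3 / 2) (Or.inr (by norm_num))
    fun_prop
  rw [intervalIntegral.integral_eq_sub_of_hasDerivAt hderiv hint]
  norm_num [Real.zero_rpow, Real.one_rpow]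

/-- `∫₀¹ r(t) dt = 1/36`. [folklore] -/
theorem integral_gramRay : ∫ t in (0:ℝ)..1, gramRay t = 1 / 36 := by
  have hcongr : EqOn (fun t : ℝ => gramRay t)
      (fun t => 1 + (-(10 / 3)) * t ^ (1 / 2 : ℝ) + 5 / 2 * t + 0 * t ^ (3 / 2 : ℝ) + 0 * t ^ 2)
      (uIcc (0:ℝ) 1) := by
    intro t _
    simp only [gramRay, Real.sqrt_eq_rpow]
    ring
  rw [intervalIntegral.integral_congr hcongr, integral_rpow_combination]
  norm_num

/-- `∫₀¹ r(t)√t dt = 0` (`r ⊥ √t`). [folklore] -/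
theorem integral_gramRay_mul_sqrt : ∫ t in (0:ℝ)..1, gramRay t * Real.sqrt t = 0 := by
  have hcongr : EqOn (fun t : ℝ => gramRay t * Real.sqrt t)
      (fun t => 0 + 1 * t ^ (1 / 2 : ℝ) + (-(10 / 3)) * t + 5 / 2 * t ^ (3 / 2 : ℝ) + 0 * t ^ 2)
      (uIcc (0:ℝ) 1) := by
    intro t ht
    rw [uIcc_of_le zero_le_one] at ht
    have ht0 : 0 ≤ t := ht.1
    have hsq : t ^ (1 / 2 : ℝ) * t ^ (1 / 2 : ℝ) = t := by
      rw [← Real.rpow_add' ht0 (by norm_num)]; norm_num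
    have h32 : t ^ (3 / 2 : ℝ) = t * t ^ (1 / 2 : ℝ) := by
      rw [show (3 / 2 : ℝ) = 1 + 1 / 2 by norm_num, Real.rpow_add' ht0 (by norm_num), Real.rpow_one]
    simp only [gramRay, Real.sqrt_eq_rpow]
    rw [h32]
    linear_combination (-(10 / 3) : ℝ) * hsq
  rw [intervalIntegral.integral_congr hcongr, integral_rpow_combination]
  norm_num

/-- `∫₀¹ r(t)·t dt = 0` (`r ⊥ t`). [folklore] -/
theorem integral_gramRay_mul_id : ∫ t in (0:ℝ)..1, gramRay t * t = 0 := by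
  have hcongr : EqOn (fun t : ℝ => gramRay t * t)
      (fun t => 0 + 0 * t ^ (1 / 2 : ℝ) + 1 * t + (-(10 / 3)) * t ^ (3 / 2 : ℝ) + 5 / 2 * t ^ 2)
      (uIcc (0:ℝ) 1) := by
    intro t ht
    rw [uIcc_of_le zero_le_one] at ht
    have ht0 : 0 ≤ t := ht.1
    have h32 : t ^ (3 / 2 : ℝ) = t * t ^ (1 / 2 : ℝ) := by
      rw [show (3 / 2 : ℝ) = 1 + 1 / 2 by norm_num, Real.rpow_add' ht0 (by norm_num), Real.rpow_one]
    simp only [gramRay, Real.sqrt_eq_rpow]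
    rw [h32]
    ring
  rw [intervalIntegral.integral_congr hcongr, integral_rpow_combination]
  norm_num

/-- `∫₀¹ r(t)² dt = 1/36` (`‖r‖² = ∫ r`; the K3 computation, here via the FTC lemma). [folklore] -/
theorem integral_gramRay_sq' : ∫ t in (0:ℝ)..1, gramRay t ^ 2 = 1 / 36 := by
  have hcongr : EqOn (fun t : ℝ => gramRay t ^ 2)
      (fun t => 1 + (-(20 / 3)) * t ^ (1 / 2 : ℝ) + 145 / 9 * t + (-(50 / 3)) * t ^ (3 / 2 : ℝ)
        + 25 / 4 * t ^ 2)
      (uIcc (0:ℝ) 1) := by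
    intro t ht
    rw [uIcc_of_le zero_le_one] at ht
    have ht0 : 0 ≤ t := ht.1
    have hsq : t ^ (1 / 2 : ℝ) * t ^ (1 / 2 : ℝ) = t := by
      rw [← Real.rpow_add' ht0 (by norm_num)]; norm_num
    have h32 : t ^ (3 / 2 : ℝ) = t * t ^ (1 / 2 : ℝ) := by
      rw [show (3 / 2 : ℝ) = 1 + 1 / 2 by norm_num, Real.rpow_add' ht0 (by norm_num), Real.rpow_one]
    simp only [gramRay, Real.sqrt_eq_rpow]
    rw [h32]
    linear_combination (100 / 9 : ℝ) * hsq
  rw [intervalIntegral.integral_congr hcongr, integral_rpow_combination]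
  norm_num

/-- `|r(t)| ≤ 5` for `t ∈ [0,1]`. [folklore] -/
theorem abs_gramRay_le {t : ℝ} (ht : t ∈ Icc (0:ℝ) 1) : |gramRay t| ≤ 5 := by
  have h0 : 0 ≤ Real.sqrt t := Real.sqrt_nonneg t
  have h1 : Real.sqrt t ≤ 1 := by
    calc Real.sqrt t ≤ Real.sqrt 1 := Real.sqrt_le_sqrt ht.2
      _ = 1 := Real.sqrt_one
  unfold gramRay
  rw [abs_le]
  constructor <;> nlinarith [ht.1, ht.2]

/-- `r` is continuous. [folklore] -/
theorem continuous_gramRay : Continuous gramRay := by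
  have := Real.continuous_sqrt
  unfold gramRay
  fun_prop

/-- Set-integral forms on `(0,1)`: `∫_{(0,1)} r = 1/36`. [folklore] -/
theorem setIntegral_gramRay : ∫ t in Ioo (0:ℝ) 1, gramRay t = 1 / 36 := by
  rw [← integral_Ioc_eq_integral_Ioo, ← intervalIntegral.integral_of_le zero_le_one]
  exact integral_gramRay

/-- `∫_{(0,1)} r² = 1/36`. [folklore] -/
theorem setIntegral_gramRay_sq : ∫ t in Ioo (0:ℝ) 1, gramRay t ^ 2 = 1 / 36 := by
  rw [← integral_Ioc_eq_integral_Ioo, ← intervalIntegral.integral_of_le zero_le_one]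
  exact integral_gramRay_sq'

/-- `∫_{(0,1)} r(t)√t dt = 0`. [folklore] -/
theorem setIntegral_gramRay_mul_sqrt : ∫ t in Ioo (0:ℝ) 1, gramRay t * Real.sqrt t = 0 := by
  rw [← integral_Ioc_eq_integral_Ioo, ← intervalIntegral.integral_of_le zero_le_one]
  exact integral_gramRay_mul_sqrt

/-- `∫_{(0,1)} r(t)·t dt = 0`. [folklore] -/
theorem setIntegral_gramRay_mul_id : ∫ t in Ioo (0:ℝ) 1, gramRay t * t = 0 := by
  rw [← integral_Ioc_eq_integral_Ioo, ← intervalIntegral.integral_of_le zero_le_one]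
  exact integral_gramRay_mul_id

end Summit.RiemannHypothesis.RiemannHypothesis.Theorems.ScrewLemmaKExtremalRay

end
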